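import Summits.HodgeConjecture.HodgeCM.Model.ArchConjFrameTransport_1

/-! PORT of `HodgeCM/Model/ArchConjFrameTransport.lean` (HodgeCMPerL run 82) — part 2: continuation of `Summits.HodgeConjecture.HodgeCM.Model.ArchConjFrameTransport_1` (split at a top-level declaration boundary by port_pkg.py; scope re-opened below; declarations unchanged). -/

-- port_pkg: scope re-opened for this part (file-level context, then the namespace/section stack open at the cut)
set_option autoImplicit false
noncomputable section
open scoped Matrix Classical SchwartzMap TensorProduct
open MvPolynomial (rename)
open NumberField (InfinitePlace maximalRealSubfield IsCMField)
open NumberField.mixedEmbedding (mixedSpace)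
open Literature.NumberTheory.Automorphic Literature.NumberTheory.Automorphic.UnitaryGroup Literature.NumberTheory.Weil1964
open Literature.RepresentationTheory.KonnoKonno2007 Literature.RepresentationTheory.KonnoKonno2007.RealDualPair
open Literature.NumberTheory.GelbartRogawski1991 Literature.NumberTheory.GelbartRogawski1991.UnitaryDualPair
open Literature.RepresentationTheory (atPlace)
open Literature.Analysis.SegalBargmann
open HodgeCM.Adelic HodgeCM.PerL34 HodgeCM.Model.HypCensus
namespace HodgeCM.Model.ArchSideTerm
section Transport
variable {L : CMField} {ι₁ : L →+* ℂ} (V : HermSpace3 L ι₁) (S : StubTree.SeesawDatum L)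
variable
  (hpos₀ : 0 < cmXW (L : Type) (frameD V) (lineVec (L : Type) (dW S 0)) (fun _ => dW_real S 0) ι₁ (HypCensus.cmPlace (L : Type) ι₁) 0)
  (hpos₁ : 0 < cmXW (L : Type) (frameD V) (lineVec (L : Type) (dW S 1)) (fun _ => dW_real S 1) ι₁ (HypCensus.cmPlace (L : Type) ι₁) 0)
  (hpos₂ : 0 < cmXW (L : Type) (frameD V) (lineVec (L : Type) (dW' S 0)) (fun _ => dW'_real S 0) ι₁ (HypCensus.cmPlace (L : Type) ι₁) 0)
  (hpos₃ : 0 < cmXW (L : Type) (frameD V) (lineVec (L : Type) (dW' S 1)) (fun _ => dW'_real S 1) ι₁ (HypCensus.cmPlace (L : Type) ι₁) 0)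
/-- **… as Schwartz maps: `Φ_{X'} ∘ J_S = Φ_X`.** -/
theorem compCLM_conjFrameTransport_slotArchBox_linePhi :
    SchwartzMap.compCLMOfContinuousLinearEquiv ℂ (conjFrameTransport V S)
        (slotArchBox (linePhi V (dW' S 0) (dW'_real S 0) (dW'_ne S 0) hpos₂) (linePhi V (dW' S 1) (dW'_real S 1) (dW'_ne S 1) hpos₃)) =
      slotArchBox (linePhi V (dW S 0) (dW_real S 0) (dW_ne S 0) hpos₀) (linePhi V (dW S 1) (dW_real S 1) (dW_ne S 1) hpos₁) := by
  ext y
  exact slotArchBox_linePhi_conjFrameTransport V S hpos₀ hpos₁ hpos₂ hpos₃ y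

/-- **… and backwards: `Φ_X (J_S⁻¹ y) = Φ_{X'} y`.** -/
theorem slotArchBox_linePhi_conjFrameTransport_symm (y : Fin (3 * 2) → mixedSpace (↥(maximalRealSubfield (L : Type)))) :
    slotArchBox (linePhi V (dW S 0) (dW_real S 0) (dW_ne S 0) hpos₀) (linePhi V (dW S 1) (dW_real S 1) (dW_ne S 1) hpos₁)
        ((conjFrameTransport V S).symm y) =
      slotArchBox (linePhi V (dW' S 0) (dW'_real S 0) (dW'_ne S 0) hpos₂) (linePhi V (dW' S 1) (dW'_real S 1) (dW'_ne S 1) hpos₃) y := by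
  rw [← slotArchBox_linePhi_conjFrameTransport V S hpos₀ hpos₁ hpos₂ hpos₃, ContinuousLinearEquiv.apply_symm_apply]

/-- the same for a `SeesawCtx` (the letters of #1217): `ctxSlotArchBox V c hpos₀ hpos₁ y = Φ_{X'} (J_{c.D} y)`. -/
theorem ctxSlotArchBox_eq_conjFrameTransport (c : SeesawCtx L)
    (hpos₀ : 0 < cmXW (L : Type) (frameD V) (lineVec (L : Type) (dW c.D 0)) (fun _ => dW_real c.D 0) ι₁ (HypCensus.cmPlace (L : Type) ι₁) 0)
    (hpos₁ : 0 < cmXW (L : Type) (frameD V) (lineVec (L : Type) (dW c.D 1)) (fun _ => dW_real c.D 1) ι₁ (HypCensus.cmPlace (L : Type) ι₁) 0)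
    (hpos₂ : 0 < cmXW (L : Type) (frameD V) (lineVec (L : Type) (dW' c.D 0)) (fun _ => dW'_real c.D 0) ι₁ (HypCensus.cmPlace (L : Type) ι₁) 0)
    (hpos₃ : 0 < cmXW (L : Type) (frameD V) (lineVec (L : Type) (dW' c.D 1)) (fun _ => dW'_real c.D 1) ι₁ (HypCensus.cmPlace (L : Type) ι₁) 0)
    (y : Fin (3 * 2) → mixedSpace (↥(maximalRealSubfield (L : Type)))) :
    ctxSlotArchBox V c hpos₀ hpos₁ y =
      slotArchBox (linePhi V (dW' c.D 0) (dW'_real c.D 0) (dW'_ne c.D 0) hpos₂) (linePhi V (dW' c.D 1) (dW'_real c.D 1) (dW'_ne c.D 1) hpos₃)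
        (conjFrameTransport V c.D y) :=
  (slotArchBox_linePhi_conjFrameTransport V c.D hpos₀ hpos₁ hpos₂ hpos₃ y).symm

end Transport

/-! ## §5 the coordinates of `J_S`: `J_S = 1_V ⊗ M` -/

section Coords

variable {L : CMField} {ι₁ : L →+* ℂ} (V : HermSpace3 L ι₁) (S : StubTree.SeesawDatum L)

/-- **the coordinates of `J_S`**: at the real place `v`, entry `(i, j)` of `J_S y` is
`(D_V(v,i) D^X_W(v, σ_v j)) / (D_V(v,i) D^{X'}_W(v, j)) · y_{(i, σ_v j), v}` with `σ_v = bitPerm S (placeUp v)` — the frame scalings of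
the SAME `V`-letter and of the two `W`-letters matched by (K7)'s sign bookkeeping. -/
theorem conjFrameTransport_apply_fst (y : Fin (3 * 2) → mixedSpace (↥(maximalRealSubfield (L : Type)))) (i : Fin 3) (j : Fin 2)
    (v : {v : InfinitePlace (↥(maximalRealSubfield (L : Type))) // v.IsReal}) :
    (conjFrameTransport V S y (finProdFinEquiv (i, j))).1 v =
      cmDV (L : Type) (frameD V) (frameD_real V) ι₁ v i * cmDW (L : Type) (frameD V) (dW S) (dW_real S) ι₁ v (bitPerm S (placeUp v) j) *
          (y (finProdFinEquiv (i, bitPerm S (placeUp v) j))).1 v /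
        (cmDV (L : Type) (frameD V) (frameD_real V) ι₁ v i * cmDW (L : Type) (frameD V) (dW' S) (dW'_real S) ι₁ v j) := by
  rw [conjFrameTransport_apply, scaledFrame_symm_apply_fst, relabelCLE_apply, conjColPerm_symm, conjColPerm_apply, scaledFrame_apply,
    colPermAt_finProdFinEquiv]
  simp only [pairScale, Equiv.symm_apply_apply]

end Coords

end HodgeCM.Model.ArchSideTerm

end
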